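import Mathlib
import HarnessLib
import Literature.Analysis.FluidPDE.VectorCalculus
import Literature.Analysis.FluidPDE.LerayProfileCalculus
import Literature.Analysis.FluidPDE.TypeIAncientMildClassical
import Summits.NavierStokesRegularity.NavierStokesRegularity.Theorems.LocalSineTubeDoorProfileAlignedWindowRigidityAncient
import Summits.NavierStokesRegularity.NavierStokesRegularity.Theorems.PoloidalWindowDoorPoloidalWindowRigidityWindow
import Summits.NavierStokesRegularity.NavierStokesRegularity.Theorems.PoloidalWindowDoorPoloidalWindowRigidityFlat
import Summits.NavierStokesRegularity.NavierStokesRegularity.Theorems.LocalSineTubeDoorBoundedSubsolutionMaxPrinciple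

/-!
# Door S11 `LocalTubeDoorHelicity`, crux K2⁗ `FrobeniusProfileRigidity` (stmt-NavierStokesRegularity-19975) — a new
# DYNAMIC stratum of the Type-I profile class: BERNOULLI profiles (head constant along streamlines) are trivial

Cell ns-regularity-ideate, stub-worker `ns-helicity-19975-w1` under the K2⁗ lead nsreg-p6 (STUB BRIEF deliverable (2):
«one new dynamic stratum, not among the 19 of `…FrobeniusProfileRigiditySharpest`»; lands
`--supports stmt-NavierStokesRegularity-19975 --as helper`; no claim).  The brief's suggested stratum — commuting
velocity/vorticity `(v·∇)ω = (ω·∇)v` — is ALREADY the tree theorem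
`…LocalLambTubeDoorGeneralisedBeltramiProfileRigidity.eq_zero_of_convect_comm` (p6 g5), so a different one is filed:

**THE BERNOULLI STRATUM.**  Let `H = p + |v|²/2` be the Bernoulli head of a classical Navier–Stokes flow.  Its
streamline derivative is `v·∇H = ⟪v, ∇p⟫ + ⟪v, (v·∇)v⟫ = −⟪v, ∂ₜv − νΔv⟫` (momentum equation; the Lamb vector
`ω × v` is orthogonal to `v`).  Steady Euler flows satisfy `v·∇H ≡ 0` (Bernoulli's theorem).  Here:

**a profile of the door family's Type-I class** (rate `‖v(t,x)‖ ≤ C/√(−t)`, continuity on the open slab,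
unit-viscosity Oseen–Duhamel identity, divergence-free slices) **whose Bernoulli head is instantaneously constant
along streamlines on every slice — in the pressure-free form `⟪v, ∂ₜv⟫ = ⟪v, Δv⟫` pointwise on the slab — vanishes
identically** (`eq_zero_of_bernoulli`), hence is not backward-singular (`not_backwardSingular_of_bernoulli`).

Proof.  Pointwise `∂ₜ|v|² = 2⟪v, ∂ₜv⟫ = 2⟪v, Δv⟫` and `Δ|v|² = 2⟪Δv, v⟫ + 2|Dv|²_F` (tree `laplacian_inner_self_eq`),
so `q = |v|²` is a bounded classical SUB-solution of the HEAT equation (no drift) on every slab `[t₀, t₁] × ℝ³`,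
`t₁ < 0`, with `q(t, ·) ≤ C²/(−t)` by the rate; the whole-space maximum principle for bounded sub-solutions
(`…BoundedSubsolutionMaxPrinciple.le_of_bounded_subsolution`, drift `0`) gives `q(t₁, x) ≤ C²/(−t₀) → 0` as
`t₀ → −∞`.  The time-differentiability and the `C²` slices come from the class (KNSS regularity:
`isTypeIAncientMild_of_class`, `IsTypeIAncientMild.contDiffOn`) — this is where the Oseen–Duhamel identity is consumed
(the parasitic slab flow `(−t)^{−1/2} e₀` of `…/FrobeniusProfileRigidity/Negative/LoadBearing` has
`⟪v, ∂ₜv⟫ = (−t)^{−2}/2 > 0 = ⟪v, Δv⟫`, so it is not a counterexample).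

Also: the local ENERGY BALANCE of a classical solution `∂ₜ|u|² − νΔ|u|² = −2ν|Du|²_F − 2 v·∇H`
(`energyDensity_balance`), the translation between the pressure form `⟪v, ∇p⟫ + ⟪v, (v·∇)v⟫ = 0` and the pressure-free
form for any classical pressure on a window (`inner_deriv_eq_inner_laplacian_of_head`,
`head_eq_zero_of_inner_deriv_eq_inner_laplacian`), and the pressure-form statement `eq_zero_of_head_streamline`.

Placement: a stratum of the FULL Type-I class (helicity not needed), independent of the settled ones — it neither
contains nor is contained in the generalised-Beltrami stratum (`curl (ω × v) ≡ 0`) or the constant-pressure-gradient /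
Burgers stratum (`∇p ≡ 0`, `|v|²` a sub-solution WITH drift `v`); on the helicity-free class it is the residue's
«Bernoulli» alternative: a K2⁗ residue prover may assume `v·∇H ≢ 0` on some slice.

WHAT THIS IS NOT: not a claim about Navier–Stokes regularity, not K2⁗ and not the registered stub — one more settled
stratum of the Type-I profile class (bears_on LADDER-NS N0, door S11).
-/

noncomputable section

-- the summit and its single sub-problem share the name (CONVENTIONS §1), as in every Theorems file
set_option linter.dupNamespace false

namespace Summit.NavierStokesRegularity.NavierStokesRegularity.Theorems.LocalHelicityTubeDoorFrobeniusProfileRigidityBernoulli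

open MeasureTheory Set Function Filter Topology TopologicalSpace Metric InnerProductSpace
open scoped RealInnerProductSpace InnerProductSpace Laplacian ContDiff
open Literature.Analysis Literature.Analysis.FluidPDE
open Summit.NavierStokesRegularity.NavierStokesRegularity.Theorems.LocalSineTubeDoorProfileAlignedWindowRigidityAncient
open Summit.NavierStokesRegularity.NavierStokesRegularity.Theorems.PoloidalWindowDoorPoloidalWindowRigidityWindow
open Summit.NavierStokesRegularity.NavierStokesRegularity.Theorems.PoloidalWindowDoorPoloidalWindowRigidityFlat
open Summit.NavierStokesRegularity.NavierStokesRegularity.Theorems.LocalSineTubeDoorBoundedSubsolutionMaxPrinciple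

variable {C : ℝ} {v : ℝ → EuclideanSpace ℝ (Fin 3) → EuclideanSpace ℝ (Fin 3)}

/-! ### the pointwise energy balance of a classical solution -/

/-- **The local energy balance.**  For a classical solution `(u, p)` of the unforced Navier–Stokes system with
viscosity `ν` on an OPEN time set `S`, the energy density `q = ⟪u, u⟫` satisfies pointwise at every `t ∈ S`, `x`:
`∂ₜq − νΔq = −2ν|Du|²_F − 2(⟪u, ∇p⟫ + ⟪u, (u·∇)u⟫)`, the last bracket being the streamline derivative `u·∇H` of the
Bernoulli head `H = p + |u|²/2` (`∂ₜ` the one-sided time derivative within `S`; `HasDerivWithinAt.inner`, the tree's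
`laplacian_inner_self_eq`, and the momentum equation paired with `u`). -/
theorem energyDensity_balance {S : Set ℝ} (hSo : IsOpen S) {ν : ℝ}
    {u : ℝ → EuclideanSpace ℝ (Fin 3) → EuclideanSpace ℝ (Fin 3)} {p : ℝ → EuclideanSpace ℝ (Fin 3) → ℝ}
    (hns : IsClassicalNSSolutionOn S ν 0 u p) {t : ℝ} (ht : t ∈ S) (x : EuclideanSpace ℝ (Fin 3)) :
    timeDerivWithin S (fun τ y => ⟪u τ y, u τ y⟫_ℝ) t x - ν * (Δ (fun y => ⟪u t y, u t y⟫_ℝ)) x =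
      -(2 * ν * frobeniusNormSq (fderiv ℝ (u t) x)) -
        2 * (⟪u t x, gradient (p t) x⟫_ℝ + ⟪u t x, convect (u t) (u t) x⟫_ℝ) := by
  have hS : UniqueDiffOn ℝ S := hSo.uniqueDiffOn
  have hU2 : ContDiff ℝ 2 (u t) := contDiff_infty.1 (hns.contDiff_velocity ht) 2
  -- (T) time derivative of `⟪u, u⟫`
  have hdu : HasDerivWithinAt (fun τ => u τ x) (timeDerivWithin S u t x) S t := by
    rw [timeDerivWithin_apply]
    exact (hns.smooth_velocity.differentiableWithinAt_time ht x).hasDerivWithinAt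
  have hT : timeDerivWithin S (fun τ y => ⟪u τ y, u τ y⟫_ℝ) t x = 2 * ⟪u t x, timeDerivWithin S u t x⟫_ℝ := by
    rw [timeDerivWithin_apply]
    have h := (hdu.inner ℝ hdu).derivWithin (hS t ht)
    rw [h, real_inner_comm (u t x), two_mul]
  -- (L) the Laplacian
  have hL : (Δ (fun y => ⟪u t y, u t y⟫_ℝ)) x =
      2 * ⟪(Δ (u t)) x, u t x⟫_ℝ + 2 * frobeniusNormSq (fderiv ℝ (u t) x) :=
    laplacian_inner_self_eq hU2 x
  -- (M) the momentum equation against `u`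
  have hM := hns.momentum t ht x
  have hW : ⟪u t x, timeDerivWithin S u t x⟫_ℝ + ⟪u t x, convect (u t) (u t) x⟫_ℝ =
      ν * ⟪u t x, (Δ (u t)) x⟫_ℝ - ⟪u t x, gradient (p t) x⟫_ℝ := by
    have h := congrArg (fun z => ⟪u t x, z⟫_ℝ) hM
    simpa only [inner_add_right, inner_sub_right, real_inner_smul_right, Pi.zero_apply, inner_zero_right,
      add_zero] using h
  have hc : ⟪(Δ (u t)) x, u t x⟫_ℝ = ⟪u t x, (Δ (u t)) x⟫_ℝ := real_inner_comm _ _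
  rw [hT, hL]
  linear_combination 2 * hW - 2 * ν * hc

/-! ### pressure form ⇔ pressure-free form of the Bernoulli condition -/

/-- **Head constant along a streamline ⇒ `⟪v, ∂ₜv⟫ = ⟪v, Δv⟫`** at a point: for a classical solution `(v, p)` of the
unit-viscosity unforced system on an open window `(t₀, 0)`, the vanishing of the streamline derivative of the Bernoulli
head `⟪v, ∇p⟫ + ⟪v, (v·∇)v⟫ = 0` at `(s, y)` gives `⟪v(s,y), ∂ₜv(s,y)⟫ = ⟪v(s,y), Δv(s)(y)⟫` (two-sided time
derivative; the momentum equation paired with `v`). -/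
theorem inner_deriv_eq_inner_laplacian_of_head {p : ℝ → EuclideanSpace ℝ (Fin 3) → ℝ} {t₀ : ℝ}
    (hcl : IsClassicalNSSolutionOn (Ioo t₀ 0) 1 0 v p) {s : ℝ} (hs : s ∈ Ioo t₀ 0) (y : EuclideanSpace ℝ (Fin 3))
    (hhead : ⟪v s y, gradient (p s) y⟫_ℝ + ⟪v s y, convect (v s) (v s) y⟫_ℝ = 0) :
    ⟪v s y, deriv (fun τ => v τ y) s⟫_ℝ = ⟪v s y, (Δ (v s)) y⟫_ℝ := by
  have hM := hcl.momentum s hs y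
  rw [timeDerivWithin_apply, derivWithin_of_isOpen isOpen_Ioo hs] at hM
  have h := congrArg (fun z => ⟪v s y, z⟫_ℝ) hM
  simp only [inner_add_right, inner_sub_right, one_smul, Pi.zero_apply, add_zero] at h
  linarith

/-- **Conversely, `⟪v, ∂ₜv⟫ = ⟪v, Δv⟫ ⇒ head constant along the streamline** at that point, for any classical
pressure on a window. -/
theorem head_eq_zero_of_inner_deriv_eq_inner_laplacian {p : ℝ → EuclideanSpace ℝ (Fin 3) → ℝ} {t₀ : ℝ}
    (hcl : IsClassicalNSSolutionOn (Ioo t₀ 0) 1 0 v p) {s : ℝ} (hs : s ∈ Ioo t₀ 0) (y : EuclideanSpace ℝ (Fin 3))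
    (hbern : ⟪v s y, deriv (fun τ => v τ y) s⟫_ℝ = ⟪v s y, (Δ (v s)) y⟫_ℝ) :
    ⟪v s y, gradient (p s) y⟫_ℝ + ⟪v s y, convect (v s) (v s) y⟫_ℝ = 0 := by
  have hM := hcl.momentum s hs y
  rw [timeDerivWithin_apply, derivWithin_of_isOpen isOpen_Ioo hs] at hM
  have h := congrArg (fun z => ⟪v s y, z⟫_ℝ) hM
  simp only [inner_add_right, inner_sub_right, one_smul, Pi.zero_apply, add_zero] at h
  linarith

/-! ### the class: Bernoulli profiles -/

/-- **The energy density of a Bernoulli profile is a sub-solution of the heat equation** at every point of the open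
slab: `τ ↦ |v(τ, x)|²` is differentiable and `∂ₜ|v|² − Δ|v|² = −2|Dv|²_F ≤ 0` (no Navier–Stokes input beyond the
joint smoothness of the class). -/
theorem energy_subsolution_of_bernoulli (hrate : HasTypeITimeDecay C v)
    (hcont : ContinuousOn (uncurry v) (Iio (0 : ℝ) ×ˢ univ))
    (hmild : ∀ s t : ℝ, s < t → t < 0 → ∀ x,
      v t x = UnboundedOperators.heatExtension (v s) (t - s) x - oseenDuhamel 1 s v v t x)
    (hdiv : ∀ t < 0, VectorCalculus.IsDivFree (v t))
    (hbern : ∀ s < 0, ∀ y, ⟪v s y, deriv (fun τ => v τ y) s⟫_ℝ = ⟪v s y, (Δ (v s)) y⟫_ℝ) {t : ℝ} (ht : t < 0)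
    (x : EuclideanSpace ℝ (Fin 3)) :
    HasDerivAt (fun τ => ⟪v τ x, v τ x⟫_ℝ) (deriv (fun τ => ⟪v τ x, v τ x⟫_ℝ) t) t ∧
      deriv (fun τ => ⟪v τ x, v τ x⟫_ℝ) t - (Δ (fun y => ⟪v t y, v t y⟫_ℝ)) x ≤ 0 := by
  have hA : IsTypeIAncientMild C v := isTypeIAncientMild_of_class hrate hcont hmild hdiv
  have hsm : IsSmoothSpaceTimeOn (Iio 0) v := hA.contDiffOn
  have hV2 : ContDiff ℝ 2 (v t) := contDiff_infty.1 (hsm.contDiff_slice ht) 2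
  -- time derivative of the velocity at `(t, x)` (two-sided: the slab is open)
  have hdv : HasDerivAt (fun τ => v τ x) (deriv (fun τ => v τ x) t) t :=
    ((hsm.differentiableWithinAt_time ht x).differentiableAt (isOpen_Iio.mem_nhds ht)).hasDerivAt
  have hq : HasDerivAt (fun τ => ⟪v τ x, v τ x⟫_ℝ)
      (⟪v t x, deriv (fun τ => v τ x) t⟫_ℝ + ⟪deriv (fun τ => v τ x) t, v t x⟫_ℝ) t := hdv.inner ℝ hdv
  refine ⟨hq.differentiableAt.hasDerivAt, ?_⟩
  have hderiv : deriv (fun τ => ⟪v τ x, v τ x⟫_ℝ) t = 2 * ⟪v t x, (Δ (v t)) x⟫_ℝ := by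
    rw [hq.deriv, real_inner_comm (v t x), ← two_mul, hbern t ht x]
  have hL : (Δ (fun y => ⟪v t y, v t y⟫_ℝ)) x =
      2 * ⟪(Δ (v t)) x, v t x⟫_ℝ + 2 * frobeniusNormSq (fderiv ℝ (v t) x) :=
    laplacian_inner_self_eq hV2 x
  rw [hderiv, hL, real_inner_comm (v t x)]
  have := frobeniusNormSq_nonneg (fderiv ℝ (v t) x)
  linarith

/-- **BERNOULLI TYPE-I PROFILES ARE TRIVIAL.**  A profile of the Type-I class (rate, continuity on the open slab,
unit-viscosity Oseen–Duhamel identity, divergence-free slices) with `⟪v(s,y), ∂ₜv(s,y)⟫ = ⟪v(s,y), Δv(s)(y)⟫` at every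
`s < 0`, `y` — equivalently, whose Bernoulli head `p + |v|²/2` is constant along streamlines on every slice for any
classical pressure (`inner_deriv_eq_inner_laplacian_of_head`) — vanishes identically: `|v|²` is a bounded sub-solution of
the heat equation on every slab `[t₀, t₁] × ℝ³`, `t₁ < 0`, so `|v(t₁, x)|² ≤ sup |v(t₀, ·)|² ≤ C²/(−t₀) → 0` as
`t₀ → −∞` (whole-space maximum principle `le_of_bounded_subsolution`, drift `0`). -/
theorem eq_zero_of_bernoulli (hrate : HasTypeITimeDecay C v)
    (hcont : ContinuousOn (uncurry v) (Iio (0 : ℝ) ×ˢ univ))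
    (hmild : ∀ s t : ℝ, s < t → t < 0 → ∀ x,
      v t x = UnboundedOperators.heatExtension (v s) (t - s) x - oseenDuhamel 1 s v v t x)
    (hdiv : ∀ t < 0, VectorCalculus.IsDivFree (v t))
    (hbern : ∀ s < 0, ∀ y, ⟪v s y, deriv (fun τ => v τ y) s⟫_ℝ = ⟪v s y, (Δ (v s)) y⟫_ℝ) :
    ∀ t < 0, ∀ x, v t x = 0 := by
  have hA : IsTypeIAncientMild C v := isTypeIAncientMild_of_class hrate hcont hmild hdiv
  have hsm : IsSmoothSpaceTimeOn (Iio 0) v := hA.contDiffOn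
  -- the energy density and its time derivative
  set q : ℝ → EuclideanSpace ℝ (Fin 3) → ℝ := fun τ y => ⟪v τ y, v τ y⟫_ℝ with hqdef
  set qt : ℝ → EuclideanSpace ℝ (Fin 3) → ℝ := fun τ y => deriv (fun τ' => q τ' y) τ with hqtdef
  -- the rate bound `q(t, x) ≤ C²/(−t)`
  have hqbd : ∀ t < 0, ∀ x, q t x ≤ C ^ 2 / (-t) := fun t ht x => by
    have h1 : ‖v t x‖ ^ 2 ≤ (C / Real.sqrt (-t)) ^ 2 := pow_le_pow_left₀ (norm_nonneg _) (hrate t ht x) 2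
    rw [div_pow, Real.sq_sqrt (by linarith)] at h1
    simpa only [hqdef, real_inner_self_eq_norm_sq] using h1
  intro t₁ ht₁ x₁
  -- `q(t₁, x₁) ≤ C²/(−t₀)` for every `t₀ < t₁`
  have hkey : ∀ t₀ < t₁, q t₁ x₁ ≤ C ^ 2 / (-t₀) := by
    intro t₀ ht₀
    -- zero drift
    have hbA : ∀ t ∈ Icc t₀ t₁, ∀ x : EuclideanSpace ℝ (Fin 3),
        ‖(fun (_ : ℝ) (_ : EuclideanSpace ℝ (Fin 3)) => (0 : EuclideanSpace ℝ (Fin 3))) t x‖ ≤ 0 :=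
      fun t _ x => by simp
    -- continuity of `q` on the closed slab
    have hq_c : ContinuousOn (uncurry q) (Icc t₀ t₁ ×ˢ univ) := by
      have hvc : ContinuousOn (uncurry v) (Icc t₀ t₁ ×ˢ univ) :=
        hcont.mono (prod_mono (fun t ht => lt_of_le_of_lt ht.2 ht₁) Subset.rfl)
      have h : ContinuousOn (fun z => ⟪uncurry v z, uncurry v z⟫_ℝ) (Icc t₀ t₁ ×ˢ univ) := hvc.inner hvc
      refine h.congr fun z _ => ?_
      simp only [hqdef, uncurry]
    -- smooth slices
    have hq2 : ∀ t ∈ Icc t₀ t₁, ContDiff ℝ 2 (q t) := fun t ht => by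
      have htn : t < 0 := lt_of_le_of_lt ht.2 ht₁
      have hV : ContDiff ℝ 2 (v t) := contDiff_infty.1 (hsm.contDiff_slice htn) 2
      exact hV.inner ℝ hV
    -- time derivative and the sub-solution inequality
    have hsub := fun t (ht : t ∈ Icc t₀ t₁) x =>
      energy_subsolution_of_bernoulli hrate hcont hmild hdiv hbern (lt_of_le_of_lt ht.2 ht₁) x
    have hqt : ∀ x, ∀ t ∈ Icc t₀ t₁, HasDerivAt (fun τ => q τ x) (qt t x) t := fun x t ht => (hsub t ht x).1
    have hlaw : ∀ t ∈ Icc t₀ t₁, ∀ x,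
        qt t x + fderiv ℝ (q t) x ((fun (_ : ℝ) (_ : EuclideanSpace ℝ (Fin 3)) =>
          (0 : EuclideanSpace ℝ (Fin 3))) t x) - (Δ (q t)) x ≤ 0 := fun t ht x => by
      have h0 : fderiv ℝ (q t) x ((fun (_ : ℝ) (_ : EuclideanSpace ℝ (Fin 3)) =>
          (0 : EuclideanSpace ℝ (Fin 3))) t x) = 0 := by simp
      rw [h0, add_zero]
      exact (hsub t ht x).2
    -- bounds
    have hbdd : ∀ t ∈ Icc t₀ t₁, ∀ x, |q t x| ≤ C ^ 2 / (-t₁) := fun t ht x => by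
      have htn : t < 0 := lt_of_le_of_lt ht.2 ht₁
      have hq0 : 0 ≤ q t x := by simp only [hqdef]; exact real_inner_self_nonneg
      rw [abs_of_nonneg hq0]
      refine (hqbd t htn x).trans ?_
      exact div_le_div_of_nonneg_left (sq_nonneg C) (by linarith) (by linarith [ht.2])
    have hinit : ∀ x, q t₀ x ≤ C ^ 2 / (-t₀) := fun x => hqbd t₀ (ht₀.trans ht₁) x
    exact le_of_bounded_subsolution ht₀ hbA hq_c hq2 hqt hlaw hbdd hinit t₁ ⟨ht₀.le, le_rfl⟩ x₁
  -- let `t₀ → −∞`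
  have hq0 : 0 ≤ q t₁ x₁ := by simp only [hqdef]; exact real_inner_self_nonneg
  have hqle : q t₁ x₁ ≤ 0 := by
    refine le_of_forall_pos_le_add fun η hη => ?_
    -- choose `t₀` with `C²/(−t₀) ≤ η`: `−t₀ ≥ C²/η`, e.g. `t₀ = t₁ − 1 − C²/η`
    set t₀ : ℝ := t₁ - 1 - C ^ 2 / η with ht₀def
    have hq' : 0 ≤ C ^ 2 / η := div_nonneg (sq_nonneg C) hη.le
    have ht₀ : t₀ < t₁ := by rw [ht₀def]; linarith
    have hnt₀ : C ^ 2 / η ≤ -t₀ := by rw [ht₀def]; linarith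
    have hpos : 0 < -t₀ := by linarith
    have h1 : C ^ 2 / (-t₀) ≤ η := by
      rw [div_le_iff₀ hpos]
      calc C ^ 2 = C ^ 2 / η * η := by field_simp
        _ ≤ -t₀ * η := mul_le_mul_of_nonneg_right hnt₀ hη.le
        _ = η * -t₀ := mul_comm _ _
    linarith [hkey t₀ ht₀]
  have hq00 : q t₁ x₁ = 0 := le_antisymm hqle hq0
  simpa only [hqdef, inner_self_eq_zero] using hq00

/-- **The Bernoulli stratum of the Type-I profile class is settled**: such a profile is not backward-singular at the
apex. -/
theorem not_backwardSingular_of_bernoulli (hrate : HasTypeITimeDecay C v)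
    (hcont : ContinuousOn (uncurry v) (Iio (0 : ℝ) ×ˢ univ))
    (hmild : ∀ s t : ℝ, s < t → t < 0 → ∀ x,
      v t x = UnboundedOperators.heatExtension (v s) (t - s) x - oseenDuhamel 1 s v v t x)
    (hdiv : ∀ t < 0, VectorCalculus.IsDivFree (v t))
    (hbern : ∀ s < 0, ∀ y, ⟪v s y, deriv (fun τ => v τ y) s⟫_ℝ = ⟪v s y, (Δ (v s)) y⟫_ℝ) :
    ¬ IsBackwardSingularPoint v 0 :=
  not_backwardSingular_of_zero (eq_zero_of_bernoulli hrate hcont hmild hdiv hbern)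

/-- **Pressure form.**  A profile of the Type-I class such that, on every slice `s < 0`, for SOME classical pressure
`p` on a window `(t₀, 0) ∋ s` the Bernoulli head `p + |v|²/2` is constant along streamlines
(`⟪v, ∇p⟫ + ⟪v, (v·∇)v⟫ = 0` on the slice), vanishes identically.  (Classical pressures on every window exist for the
class, `IsTypeIAncientMild.exists_isClassicalNSSolutionOn_Ioo`; any two have the same gradient, so «some» = «every».) -/
theorem eq_zero_of_head_streamline (hrate : HasTypeITimeDecay C v)
    (hcont : ContinuousOn (uncurry v) (Iio (0 : ℝ) ×ˢ univ))
    (hmild : ∀ s t : ℝ, s < t → t < 0 → ∀ x,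
      v t x = UnboundedOperators.heatExtension (v s) (t - s) x - oseenDuhamel 1 s v v t x)
    (hdiv : ∀ t < 0, VectorCalculus.IsDivFree (v t))
    (hhead : ∀ s < 0, ∃ t₀ < s, ∃ p : ℝ → EuclideanSpace ℝ (Fin 3) → ℝ,
      IsClassicalNSSolutionOn (Ioo t₀ 0) 1 0 v p ∧
        ∀ y, ⟪v s y, gradient (p s) y⟫_ℝ + ⟪v s y, convect (v s) (v s) y⟫_ℝ = 0) :
    ∀ t < 0, ∀ x, v t x = 0 := by
  refine eq_zero_of_bernoulli hrate hcont hmild hdiv fun s hs y => ?_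
  obtain ⟨t₀, ht₀, p, hcl, hh⟩ := hhead s hs
  exact inner_deriv_eq_inner_laplacian_of_head hcl ⟨ht₀, hs⟩ y (hh y)

/-- **Pressure form, not backward-singular.** -/
theorem not_backwardSingular_of_head_streamline (hrate : HasTypeITimeDecay C v)
    (hcont : ContinuousOn (uncurry v) (Iio (0 : ℝ) ×ˢ univ))
    (hmild : ∀ s t : ℝ, s < t → t < 0 → ∀ x,
      v t x = UnboundedOperators.heatExtension (v s) (t - s) x - oseenDuhamel 1 s v v t x)
    (hdiv : ∀ t < 0, VectorCalculus.IsDivFree (v t))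
    (hhead : ∀ s < 0, ∃ t₀ < s, ∃ p : ℝ → EuclideanSpace ℝ (Fin 3) → ℝ,
      IsClassicalNSSolutionOn (Ioo t₀ 0) 1 0 v p ∧
        ∀ y, ⟪v s y, gradient (p s) y⟫_ℝ + ⟪v s y, convect (v s) (v s) y⟫_ℝ = 0) :
    ¬ IsBackwardSingularPoint v 0 :=
  not_backwardSingular_of_zero (eq_zero_of_head_streamline hrate hcont hmild hdiv hhead)

end Summit.NavierStokesRegularity.NavierStokesRegularity.Theorems.LocalHelicityTubeDoorFrobeniusProfileRigidityBernoulli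

end
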